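import Mathlib
import Summits.Ventures.PercRepro2.TypedSpineHered

/-!
# The unmarked typed vertices: a hereditary count (blind cell PercRepro2, mine-2 g42, 2026-08-29;
`proofs/MINE2-SIXV.md` §2)

The ends of the typed edges outside the five marks (`unmarkedTyped`).  The reduction calculus
never creates one: shrinking the typed set drops some, and a contraction maps them into the images
of the old ones (`unmarkedTyped_contract_subset`) — so «at most `k` unmarked typed vertices» is a
hereditary class in the sense of TypedSpineHered.lean (`hereditary_unmarked_le`), and on a vertex
type with `|V| ≤ |marks| + 1` there is at most one (`card_unmarkedTyped_le`).

Own code; standard axioms.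
-/

namespace Summit.Ventures.PercRepro2

open UnionCluster

namespace CovForm

namespace TypedRed

open Contract

/-! ## The unmarked typed vertices: a hereditary count -/

section Unmarked

variable {V : Type*} {E : Type*} [Fintype V] [DecidableEq V] [Fintype E] [DecidableEq E]

/-- The vertices touched by a typed edge. -/
def typedVerts (ends : E → Sym2 V) (F : Finset E) : Finset V :=
  F.biUnion fun e => Finset.univ.filter fun v => v ∈ ends e

omit [Fintype E] [DecidableEq E] in
/-- Membership in the typed vertices. -/
lemma mem_typedVerts {ends : E → Sym2 V} {F : Finset E} {v : V} :
    v ∈ typedVerts ends F ↔ ∃ e ∈ F, v ∈ ends e := by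
  simp [typedVerts]

omit [Fintype E] [DecidableEq E] in
/-- The typed vertices are monotone in the typed set. -/
lemma typedVerts_mono {ends : E → Sym2 V} {F F' : Finset E} (h : F' ⊆ F) :
    typedVerts ends F' ⊆ typedVerts ends F :=
  Finset.biUnion_subset_biUnion_of_subset_left _ h

omit [Fintype E] [DecidableEq E] in
/-- The typed vertices of a contraction are the images of the typed vertices. -/
lemma typedVerts_contract (ends : E → Sym2 V) (W : Finset V) (w : V) (F : Finset E) :
    typedVerts (contractEnds ends W w) F = (typedVerts ends F).image (contractMap W w) := by
  ext v
  simp only [mem_typedVerts, Finset.mem_image, contractEnds, Sym2.mem_map]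
  constructor
  · rintro ⟨e, he, x, hx, rfl⟩
    exact ⟨x, ⟨e, he, hx⟩, rfl⟩
  · rintro ⟨x, ⟨e, he, hx⟩, rfl⟩
    exact ⟨e, he, x, hx, rfl⟩

/-- The five marks as a finite set. -/
def markSet (o a₁ a₂ a₃ b : V) : Finset V := {o, a₁, a₂, a₃, b}

omit [Fintype V] [Fintype E] [DecidableEq E] in
/-- Membership in the marks. -/
lemma mem_markSet {o a₁ a₂ a₃ b v : V} :
    v ∈ markSet o a₁ a₂ a₃ b ↔ v = o ∨ v = a₁ ∨ v = a₂ ∨ v = a₃ ∨ v = b := by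
  simp [markSet]

omit [Fintype V] [Fintype E] [DecidableEq E] in
/-- The marks of a contraction are the images of the marks. -/
lemma markSet_contract (W : Finset V) (w : V) (o a₁ a₂ a₃ b : V) :
    markSet (contractMap W w o) (contractMap W w a₁) (contractMap W w a₂) (contractMap W w a₃)
      (contractMap W w b) = (markSet o a₁ a₂ a₃ b).image (contractMap W w) := by
  simp [markSet, Finset.image_insert, Finset.image_singleton]

/-- **The unmarked typed vertices**: the ends of typed edges outside the five marks. -/
def unmarkedTyped (ends : E → Sym2 V) (o a₁ a₂ a₃ b : V) (F : Finset E) : Finset V :=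
  typedVerts ends F \ markSet o a₁ a₂ a₃ b

omit [Fintype E] [DecidableEq E] in
/-- Membership in the unmarked typed vertices. -/
lemma mem_unmarkedTyped {ends : E → Sym2 V} {o a₁ a₂ a₃ b v : V} {F : Finset E} :
    v ∈ unmarkedTyped ends o a₁ a₂ a₃ b F ↔
      (∃ e ∈ F, v ∈ ends e) ∧ v ≠ o ∧ v ≠ a₁ ∧ v ≠ a₂ ∧ v ≠ a₃ ∧ v ≠ b := by
  unfold unmarkedTyped
  rw [Finset.mem_sdiff, mem_typedVerts, mem_markSet, not_or, not_or, not_or, not_or]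

omit [Fintype E] [DecidableEq E] in
/-- The unmarked typed vertices are monotone in the typed set. -/
lemma unmarkedTyped_mono {ends : E → Sym2 V} {o a₁ a₂ a₃ b : V} {F F' : Finset E} (h : F' ⊆ F) :
    unmarkedTyped ends o a₁ a₂ a₃ b F' ⊆ unmarkedTyped ends o a₁ a₂ a₃ b F :=
  Finset.sdiff_subset_sdiff (typedVerts_mono h) (Finset.Subset.refl _)

omit [Fintype E] [DecidableEq E] in
/-- An unmarked typed vertex of a contraction is the image of an unmarked typed vertex. -/
lemma unmarkedTyped_contract_subset (ends : E → Sym2 V) (W : Finset V) (w : V) (o a₁ a₂ a₃ b : V)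
    (F : Finset E) :
    unmarkedTyped (contractEnds ends W w) (contractMap W w o) (contractMap W w a₁)
        (contractMap W w a₂) (contractMap W w a₃) (contractMap W w b) F ⊆
      (unmarkedTyped ends o a₁ a₂ a₃ b F).image (contractMap W w) := by
  intro v hv
  rw [unmarkedTyped, Finset.mem_sdiff, typedVerts_contract, markSet_contract, Finset.mem_image] at hv
  obtain ⟨⟨x, hx, rfl⟩, hn⟩ := hv
  exact Finset.mem_image.2
    ⟨x, Finset.mem_sdiff.2 ⟨hx, fun hxM => hn (Finset.mem_image_of_mem _ hxM)⟩, rfl⟩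

omit [Fintype E] [DecidableEq E] in
/-- A contraction does not increase the number of unmarked typed vertices. -/
lemma card_unmarkedTyped_contract_le (ends : E → Sym2 V) (W : Finset V) (w : V) (o a₁ a₂ a₃ b : V)
    (F : Finset E) :
    (unmarkedTyped (contractEnds ends W w) (contractMap W w o) (contractMap W w a₁)
        (contractMap W w a₂) (contractMap W w a₃) (contractMap W w b) F).card ≤
      (unmarkedTyped ends o a₁ a₂ a₃ b F).card :=
  (Finset.card_le_card (unmarkedTyped_contract_subset ends W w o a₁ a₂ a₃ b F)).trans
    Finset.card_image_le

omit [Fintype E] [DecidableEq E] in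
/-- **The class «at most `k` unmarked typed vertices» is hereditary** for the reduction calculus. -/
theorem hereditary_unmarked_le (k : ℕ) :
    Hereditary (fun (ends : E → Sym2 V) (o a₁ a₂ a₃ b : V) (F : Finset E) =>
      (unmarkedTyped ends o a₁ a₂ a₃ b F).card ≤ k) where
  mono := fun _ _ _ _ _ _ _ _ h hk => (Finset.card_le_card (unmarkedTyped_mono h)).trans hk
  contract := fun ends o a₁ a₂ a₃ b F u v hk =>
    (card_unmarkedTyped_contract_le ends {u, v} u o a₁ a₂ a₃ b F).trans hk

omit [Fintype E] [DecidableEq E] in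
/-- At most `|V| − |marks|` unmarked typed vertices. -/
lemma card_unmarkedTyped_le (ends : E → Sym2 V) (o a₁ a₂ a₃ b : V) (F : Finset E) :
    (unmarkedTyped ends o a₁ a₂ a₃ b F).card ≤ Fintype.card V - (markSet o a₁ a₂ a₃ b).card := by
  calc (unmarkedTyped ends o a₁ a₂ a₃ b F).card
      ≤ (Finset.univ \ markSet o a₁ a₂ a₃ b).card :=
        Finset.card_le_card
          (Finset.sdiff_subset_sdiff (Finset.subset_univ _) (Finset.Subset.refl _))
    _ = Fintype.card V - (markSet o a₁ a₂ a₃ b).card := by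
        rw [Finset.card_sdiff_of_subset (Finset.subset_univ _), Finset.card_univ]

omit [Fintype V] [Fintype E] [DecidableEq E] in
/-- Five distinct marks. -/
lemma card_markSet_of_distinct {o a₁ a₂ a₃ b : V} (h12 : a₁ ≠ a₂) (h13 : a₁ ≠ a₃) (h23 : a₂ ≠ a₃)
    (ho1 : o ≠ a₁) (ho2 : o ≠ a₂) (ho3 : o ≠ a₃) (hob : o ≠ b) (hb1 : b ≠ a₁) (hb2 : b ≠ a₂)
    (hb3 : b ≠ a₃) : (markSet o a₁ a₂ a₃ b).card = 5 := by
  rw [markSet, Finset.card_insert_of_notMem, Finset.card_insert_of_notMem,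
    Finset.card_insert_of_notMem, Finset.card_insert_of_notMem, Finset.card_singleton]
  · simp [hb3.symm]
  · simp [h23, hb2.symm]
  · simp [h12, h13, hb1.symm]
  · simp [ho1, ho2, ho3, hob]

end Unmarked

end TypedRed

end CovForm

end Summit.Ventures.PercRepro2
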